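import Summits.NavierStokesRegularity.FunctionalMining.TopEigAmplitudeFloorHolds
import Summits.NavierStokesRegularity.FunctionalMining.TopEigHeatStable
import Summits.NavierStokesRegularity.FunctionalMining.BiaxialEikonalObstruction
import Literature.Analysis.FunctionSpaces.TorusLipschitzGradient
import HarnessLib

/-!
# FunctionalMining / NoGo — K53: an EXACT (F2) witness has a CONSTANT top strain eigenvalue
# (ISO-TOP), and is then exact at EVERY exponent; a non-constant `λ₁` pays a positive heat price
# at every real `q ≥ 2`

HONEST FRAMING. Search for candidate a priori estimates; no regularity claim. Nothing about
Navier–Stokes is proved or asserted in this file. Cell `pub-nsfunc`, no-go seat (gen 51, touch 1).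
Static calculus of smooth fields on the flat torus.

CONTEXT. Door (b)/(F2) of `NOGO.md` is the WANTED kernel negation `¬ TopEigHeatCoercivePos q` of the
open node Lemma L-λ(q) (`TopEigHeatCoercive.lean`). The cellʼs portrait of an EXACT witness — a smooth
divergence-free `v` on `T³` with `Φ_q(v) = ∫(λ₁⁺)^q > 0` and `heatDissipation Φ_q v = 0` — so far:
balanced Danskin mass and a twin point `λ₂ = λ₁` (staged K48), pointwise stationarity ⇒ flat a.e.
(K48 § 4), exact-exponent set isolated or all of `(1, ∞)` (K50), no strict sign of the Danskin mass on a
visited spectral window and a frozen top (K51/K52). This file adds the AMPLITUDE side, which the tree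
already controls: the kernel theorem LEMMA AF (`topEigAmplitudeFloor_of_two_le`, census-2 / prove,
`TopEigAmplitudeFloorHolds`) `q(q−1) ∫ λ₁^{q−2} Σᵢ(∂ᵢλ₁)² ≤ heatDissipation Φ_q v` (real `q ≥ 2`,
junk-valued partials of the Lipschitz function `λ₁ = λ₁ ∘ S_v`, the junk set null by Rademacher).
Pen precursor: SIEVELD §3.4b (3) Lemma R0 ("`D₀ = 0` forces `∇λ₁ = 0` and `∇e₁ = 0` on the set where
`λ₁` is simple; if `λ₁` is simple on a connected open set of full measure then `D₀ > 0`"). The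
kernel statement below needs NO simplicity and NO connectedness hypothesis for the eigenvalue half:
the floor sees `∇λ₁` across eigenvalue crossings (Lipschitz calculus), and a Lipschitz function
with a.e. vanishing gradient is constant on the whole torus.

CONTENT (`λ₁ = torusStrainTopEig v`; `card d = 3` inside the hypotheses, the cellʼs convention):
* § 1 (`IsoTop`, pure torus analysis, every `d`) **a Lipschitz function on `T^d` whose gradient
  vanishes almost everywhere is constant** (`IsoTop.eq_of_gradient_eq_zero_ae`): its mollifications
  `ζ ⋆ k_ε` have gradient `∫ k_ε(x − y) ∇ζ(y) dy = 0` (Literature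
  `Torus.gradient_convolution_of_lipschitz`, Rademacher), hence are constant (the treeʼs
  `BiaxialEikonal.eq_of_forall_partialDeriv_eq_zero`), and converge uniformly to `ζ` (Literature
  `Torus.exists_forall_dist_convolution_le`).
* § 2 **`IsoTop.gradient_topEig_eq_zero_ae`**: if `heatDissipation Φ_q v ≤ 0` for some real `q ≥ 2`
  (smooth divergence-free `v`, `card d = 3`), then `∇λ₁ = 0` a.e.: the floor integrand
  `λ₁^{q−2} Σᵢ(∂ᵢλ₁)²` is non-negative, integrable (tree) and has integral `≤ 0`, so it vanishes a.e.;
  at a Rademacher point either all partials vanish, or `λ₁ = 0` — a global minimum of `λ₁ ≥ 0`, where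
  the derivative vanishes by Fermat.
* § 3 **`torusStrainTopEig_eq_of_heatDissipation_nonpos` (ISO-TOP)**: under the same hypotheses
  `λ₁(x) = λ₁(y)` for all `x, y` — **an exact (F2) witness at any real exponent `q ≥ 2` has a CONSTANT
  top strain eigenvalue `λ₁ ≡ m` on the whole torus**, with `Φ_q(v) = m^q`
  (`torusTopEigMoment_eq_rpow_of_heatDissipation_nonpos`, every real exponent). Contrapositives
  (`heatDissipation_topEigMoment_pos_of_ne`, `…_pos_of_topEig_eq_zero`): a design whose top strain
  eigenvalue takes two values — e.g. `Φ_q > 0` with `λ₁ = 0` somewhere (a strain zero) — has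
  `heatDissipation Φ_q v > 0` at EVERY real `q ≥ 2`.
* § 4 (`T³ = UnitAddTorus (Fin 3)`, where the treeʼs heat sieve `0 ≤ heatDissipation Φ_q v` lives)
  **`heatDissipation_topEigMoment_eq_zero_of_exact` (EXACT ONCE ⇒ EXACT ALWAYS)**: if
  `heatDissipation Φ_{q₀} v ≤ 0` for ONE real `q₀ ≥ 2`, then `heatDissipation Φ_q v = 0` for EVERY real
  `q > 1` — by ISO-TOP and Danskinʼs formula `heatDissipation Φ_q v = −q m^{q−1} ∫ μ(S; ΔS)`
  (`TopEig.heatDissipation_topEigMoment_eq_integral`), the sign of one number `∫ μ` decides all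
  exponents at once. This SHARPENS K50 (R8) ("the exact-exponent set of a design is isolated or all of
  `(1, ∞)`"): an exponent `q₀ ≥ 2` is never an isolated exact exponent.

MEANING FOR (F2) (design rule (R11), records only). An exact witness against L-λ(q), `q ≥ 2`, lives in
the rigid class `{λ₁(S_v) ≡ const}` and is then universal (exact at every `q > 1`: ALL of K47–K52
apply to it at once); every design with a non-constant top strain eigenvalue — every laminate, every
field with a strain zero, every member of the (F1)/W18 family — has a POSITIVE heat price at every
`q ≥ 2`, so (F2) for such designs is a statement about FAMILIES (`topEigHeatRate q = 0`), never about
one field. Whether a smooth periodic divergence-free `v ≢ 0` with `λ₁(S_v) ≡ const` exists is OPEN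
here. NOT here: `1 < q < 2` (the floor is proved for `q ≥ 2` only), the quantitative (Poincaré)
version, any verdict change: L-λ(q) OPEN ∀ real q > 1; no 𝒦₀ row, no A12 count, no T_LD input.
[ours = §§ 2–4 and the assembly of § 1; folklore = mollification / Rademacher / Fermat]
FILING (prove seat g29, REQUEST #79): declarations byte-identical to the no-go seat's staged `TopEigHeatIsoTop.STAGING.lean` 32d48153bf5d7e51; this line is the only addition.
-/

noncomputable section

open MeasureTheory Set Filter Topology Metric
open scoped Convolution InnerProductSpace NNReal

namespace Summit.NavierStokesRegularity.FunctionalMining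

open Literature.Analysis.FunctionSpaces Literature.Analysis.FunctionSpaces.Torus
  Literature.Analysis.FluidPDE

variable {d : Type*} [Fintype d] [DecidableEq d]

namespace TopEig

namespace IsoTop

/-! ## § 1 A Lipschitz function on `T^d` with a.e. vanishing gradient is constant -/

section Liouville

variable {K : ℝ≥0} {ζ : UnitAddTorus d → ℝ}

/-- A mollification `ζ ⋆ k_ε` of a Lipschitz `ζ` with `∇ζ = 0` a.e. has vanishing gradient
`∇(ζ ⋆ k)(x) = ∫ k(x − y) ∇ζ(y) dy = 0` (Literature `TorusRademacher`), hence vanishing partials, so it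
is CONSTANT (tree `BiaxialEikonal.eq_of_forall_partialDeriv_eq_zero`). [folklore] -/
theorem mollify_eq_mollify (hζ : LipschitzWith K ζ)
    (h0 : ∀ᵐ y ∂(volume : Measure (UnitAddTorus d)), Torus.gradient ζ y = 0)
    {ε : ℝ} (hε : 0 < ε) (hε' : ε ≤ 1 / 4) (x y : UnitAddTorus d) :
    (ζ ⋆ Torus.kernel ε) x = (ζ ⋆ Torus.kernel ε) y := by
  have hgrad : ∀ z, Torus.gradient (ζ ⋆ Torus.kernel ε) z = 0 := fun z => by
    rw [Torus.gradient_convolution_of_lipschitz hζ (Torus.isSmooth_kernel hε hε') z]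
    have hae : (fun w => Torus.kernel ε (z - w) • Torus.gradient ζ w) =ᵐ[volume]
        fun _ => (0 : EuclideanSpace ℝ d) := by
      filter_upwards [h0] with w hw
      rw [hw, smul_zero]
    rw [integral_congr_ae hae, integral_zero]
  have h1 : Torus.IsContDiff 1 (ζ ⋆ Torus.kernel ε) :=
    (Torus.isSmooth_convolution hζ.continuous.integrable_unitAddTorus
      (Torus.isSmooth_kernel hε hε')).isContDiff (by simp)
  refine BiaxialEikonal.eq_of_forall_partialDeriv_eq_zero h1 (fun j z => ?_) x y
  rw [← Torus.gradient_apply h1, hgrad z]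
  rfl

omit [DecidableEq d] in
/-- **Liouville for Lipschitz functions on the torus.** A Lipschitz `ζ : T^d → ℝ` whose (junk-valued,
a.e. genuine by Rademacher) gradient `Torus.gradient ζ` vanishes almost everywhere is constant:
the constant mollifications `ζ ⋆ k_ε` converge to `ζ` uniformly. [folklore; ours = assembly] -/
theorem eq_of_gradient_eq_zero_ae (hζ : LipschitzWith K ζ)
    (h0 : ∀ᵐ y ∂(volume : Measure (UnitAddTorus d)), Torus.gradient ζ y = 0)
    (x y : UnitAddTorus d) : ζ x = ζ y := by
  classical
  have key : ∀ η : ℝ, 0 < η → dist (ζ x) (ζ y) ≤ η + η := by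
    intro η hη
    obtain ⟨δ, hδ, hclose⟩ := Torus.exists_forall_dist_convolution_le hζ.continuous hη
    set ε : ℝ := min (δ / 2) (1 / 4) with hεdef
    have hε : 0 < ε := lt_min (half_pos hδ) (by norm_num)
    have hε' : ε ≤ 1 / 4 := min_le_right _ _
    have hsupp : Function.support (Torus.kernel (d := d) ε) ⊆ ball 0 δ :=
      (Torus.support_kernel_subset hε).trans
        (Metric.ball_subset_ball ((min_le_left _ _).trans (half_le_self hδ.le)))
    have hk : ∀ z, dist ((Torus.kernel ε ⋆ ζ) z) (ζ z) ≤ η := fun z =>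
      hclose hsupp (fun w => Torus.kernel_nonneg hε.le w) (Torus.integral_kernel hε hε') z
    have hcomm : Torus.kernel ε ⋆ ζ = ζ ⋆ Torus.kernel ε := Torus.convolution_comm_real _ _
    have hc : (ζ ⋆ Torus.kernel ε) x = (ζ ⋆ Torus.kernel ε) y := mollify_eq_mollify hζ h0 hε hε' x y
    calc dist (ζ x) (ζ y)
        ≤ dist (ζ x) ((Torus.kernel ε ⋆ ζ) x) + dist ((Torus.kernel ε ⋆ ζ) x) (ζ y) :=
          dist_triangle _ _ _
      _ ≤ η + η := by
          refine add_le_add ?_ ?_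
          · rw [dist_comm]; exact hk x
          · rw [hcomm, hc, ← hcomm]; exact hk y
  refine dist_le_zero.1 (le_of_forall_pos_le_add fun η hη => ?_)
  linarith [key (η / 2) (half_pos hη)]

end Liouville

/-! ## § 2 Exactness at one `q ≥ 2` forces `∇λ₁ = 0` almost everywhere -/

section Gradient

variable {v : UnitAddTorus d → EuclideanSpace ℝ d} {q : ℝ}

/-- **The floor integrand vanishes a.e. on an exact design.** If `heatDissipation Φ_q v ≤ 0` for a
real `q ≥ 2` and a smooth divergence-free `v` (`card d = 3`), then for a.e. `x` and every axis `i`,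
`λ₁(x)^{q−2} (∂ᵢλ₁(x))² = 0` — LEMMA AF (`topEigAmplitudeFloor_of_two_le`) bounds the integral of the
non-negative integrable (tree, `tendsto_integral_slope_mul_slope`) function `λ₁^{q−2} Σᵢ(∂ᵢλ₁)²` by
`heatDissipation Φ_q v / (q(q−1)) ≤ 0`. [ours] -/
theorem floorIntegrand_eq_zero_ae (hd : Fintype.card d = 3) (hq : 2 ≤ q) (hv : Torus.IsSmooth v)
    (hdv : Torus.IsDivFree v) (hT : heatDissipation (torusTopEigMoment q) v ≤ 0) :
    ∀ᵐ x ∂(volume : Measure (UnitAddTorus d)), ∀ i,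
      torusStrainTopEig v x ^ (q - 2) * Torus.partialDeriv i (torusStrainTopEig v) x ^ 2 = 0 := by
  haveI : Nonempty d := Fintype.card_pos_iff.mp (by omega)
  set L := torusStrainTopEig v with hL
  have hqq : 0 < q * (q - 1) := mul_pos (by linarith) (by linarith)
  have hLnn : ∀ y, 0 ≤ L y := fun y => by
    rw [hL, ← lam_strainFlat]; exact lam_strainFlat_nonneg hv hdv y
  -- the per-axis integrands are integrable (tree)
  have hint : ∀ i, Integrable (fun x => q * (q - 1) * L x ^ (q - 2) *
      Torus.partialDeriv i L x ^ 2) volume :=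
    fun i => (tendsto_integral_slope_mul_slope hq hv hdv i).1
  set f : UnitAddTorus d → ℝ := fun x => L x ^ (q - 2) * ∑ i, Torus.partialDeriv i L x ^ 2 with hf
  have hf_nn : ∀ x, 0 ≤ f x := fun x =>
    mul_nonneg (Real.rpow_nonneg (hLnn x) _) (Finset.sum_nonneg fun i _ => sq_nonneg _)
  have hq0 : q ≠ 0 := (by linarith : (0 : ℝ) < q).ne'
  have hq1 : q - 1 ≠ 0 := (by linarith : (0 : ℝ) < q - 1).ne'
  have hf_eq : f = fun x => ∑ i, (q * (q - 1))⁻¹ * (q * (q - 1) * L x ^ (q - 2) *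
      Torus.partialDeriv i L x ^ 2) := by
    funext x
    simp only [hf, Finset.mul_sum]
    refine Finset.sum_congr rfl fun i _ => ?_
    field_simp
  have hf_int : Integrable f volume := by
    rw [hf_eq]
    exact integrable_finsetSum _ fun i _ => (hint i).const_mul _
  -- the floor
  have hfloor : q * (q - 1) * ∫ x, f x ≤ heatDissipation (torusTopEigMoment q) v :=
    topEigAmplitudeFloor_of_two_le (d := d) hq hd v hv hdv
  have hI0 : ∫ x, f x = 0 := by
    have h1 : 0 ≤ ∫ x, f x := integral_nonneg hf_nn
    have h2 : q * (q - 1) * ∫ x, f x ≤ 0 := hfloor.trans hT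
    nlinarith
  have hae : f =ᵐ[volume] 0 := (integral_eq_zero_iff_of_nonneg (fun x => hf_nn x) hf_int).1 hI0
  filter_upwards [hae] with x hx
  intro i
  have hx' : L x ^ (q - 2) * ∑ j, Torus.partialDeriv j L x ^ 2 = 0 := hx
  rcases mul_eq_zero.1 hx' with h | h
  · rw [h, zero_mul]
  · have hi : Torus.partialDeriv i L x ^ 2 = 0 :=
      (Finset.sum_eq_zero_iff_of_nonneg fun j _ => sq_nonneg (Torus.partialDeriv j L x)).1 h i
        (Finset.mem_univ i)
    rw [hi, mul_zero]

omit [DecidableEq d] in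
/-- At a global minimum point of a function on the torus the (junk-valued) torus derivative vanishes
(Fermat for the re-centred lift). [folklore] -/
theorem torusFderiv_eq_zero_of_forall_le {ζ : UnitAddTorus d → ℝ} {x : UnitAddTorus d}
    (hmin : ∀ z, ζ x ≤ ζ z) : Torus.fderiv ζ x = 0 := by
  have hloc : IsLocalMin (Torus.liftAt ζ x) 0 :=
    Filter.Eventually.of_forall fun w => by
      rw [Torus.liftAt_apply_zero, Torus.liftAt_apply]; exact hmin _
  exact hloc.fderiv_eq_zero

/-- A continuous linear form on `ℝ^d` vanishing on the standard basis vanishes. [folklore] -/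
theorem clm_eq_zero_of_forall_single {D : EuclideanSpace ℝ d →L[ℝ] ℝ}
    (h : ∀ i, D (EuclideanSpace.single i (1 : ℝ)) = 0) : D = 0 := by
  ext w
  rw [Torus.eq_sum_smul_single w, map_sum]
  simp [map_smul, h]

/-- **Exactness at one `q ≥ 2` freezes the top eigenvalue gradient:** `∇λ₁ = 0` almost everywhere.
At a Rademacher point of the Lipschitz `λ₁` (tree `exists_lipschitzWith_torusStrainTopEig`,
Literature `Torus.ae_differentiableAt_liftAt`) where the floor integrand vanishes: if `λ₁(x) > 0` all
partials vanish; if `λ₁(x) = 0` the point is a global minimum of `λ₁ ≥ 0` (Fermat). [ours] -/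
theorem gradient_topEig_eq_zero_ae (hd : Fintype.card d = 3) (hq : 2 ≤ q) (hv : Torus.IsSmooth v)
    (hdv : Torus.IsDivFree v) (hT : heatDissipation (torusTopEigMoment q) v ≤ 0) :
    ∀ᵐ x ∂(volume : Measure (UnitAddTorus d)), Torus.gradient (torusStrainTopEig v) x = 0 := by
  haveI : Nonempty d := Fintype.card_pos_iff.mp (by omega)
  set L := torusStrainTopEig v with hL
  have hLnn : ∀ y, 0 ≤ L y := fun y => by
    rw [hL, ← lam_strainFlat]; exact lam_strainFlat_nonneg hv hdv y
  obtain ⟨K, hK⟩ := exists_lipschitzWith_torusStrainTopEig hv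
  filter_upwards [floorIntegrand_eq_zero_ae hd hq hv hdv hT, Torus.ae_differentiableAt_liftAt hK]
    with x hx hdiff
  have hfd : Torus.fderiv L x = 0 := by
    rcases eq_or_lt_of_le (hLnn x) with h0 | hpos
    · exact torusFderiv_eq_zero_of_forall_le fun z => by rw [← h0]; exact hLnn z
    · refine clm_eq_zero_of_forall_single fun i => ?_
      rw [← partialDeriv_topEig_eq hdiff i]
      rcases mul_eq_zero.1 (hx i) with h' | h'
      · exact absurd h' (Real.rpow_pos_of_pos hpos _).ne'
      · exact pow_eq_zero_iff (n := 2) (by norm_num) |>.1 h'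
  rw [Torus.gradient_eq_toDual_symm_torusFderiv, hfd, map_zero]

end Gradient

end IsoTop

/-! ## § 3 ISO-TOP: an exact design has a constant top strain eigenvalue -/

section IsoTop

variable {v : UnitAddTorus d → EuclideanSpace ℝ d} {q : ℝ}

/-- **ISO-TOP.** On `T³` (`card d = 3`), a smooth divergence-free `v` with
`heatDissipation Φ_q v ≤ 0` for some real `q ≥ 2` — in particular an EXACT (F2) witness — has a
CONSTANT top strain eigenvalue: `λ₁(S_v)(x) = λ₁(S_v)(y)` for all `x, y`. [ours] -/
theorem torusStrainTopEig_eq_of_heatDissipation_nonpos (hd : Fintype.card d = 3) (hq : 2 ≤ q)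
    (hv : Torus.IsSmooth v) (hdv : Torus.IsDivFree v)
    (hT : heatDissipation (torusTopEigMoment q) v ≤ 0) (x y : UnitAddTorus d) :
    torusStrainTopEig v x = torusStrainTopEig v y := by
  haveI : Nonempty d := Fintype.card_pos_iff.mp (by omega)
  obtain ⟨K, hK⟩ := exists_lipschitzWith_torusStrainTopEig hv
  exact IsoTop.eq_of_gradient_eq_zero_ae hK (IsoTop.gradient_topEig_eq_zero_ae hd hq hv hdv hT) x y

/-- The value of a frozen top: `Φ_p(v) = λ₁(x₀)^p` for every `x₀` and every real exponent `p`
(in particular `Φ_q(v) = m^q`). [ours] -/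
theorem torusTopEigMoment_eq_rpow_of_heatDissipation_nonpos (hd : Fintype.card d = 3) (hq : 2 ≤ q)
    (hv : Torus.IsSmooth v) (hdv : Torus.IsDivFree v)
    (hT : heatDissipation (torusTopEigMoment q) v ≤ 0) (x₀ : UnitAddTorus d) (p : ℝ) :
    torusTopEigMoment p v = torusStrainTopEig v x₀ ^ p := by
  haveI : Nonempty d := Fintype.card_pos_iff.mp (by omega)
  have hnn : 0 ≤ torusStrainTopEig v x₀ := by
    rw [← lam_strainFlat]; exact lam_strainFlat_nonneg hv hdv x₀
  have hconst : ∀ x, torusStrainTopEig v x = torusStrainTopEig v x₀ := fun x =>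
    torusStrainTopEig_eq_of_heatDissipation_nonpos hd hq hv hdv hT x x₀
  unfold torusTopEigMoment
  simp_rw [hconst, max_eq_left hnn]
  simp

/-- **Design rule (R11), contrapositive form: a non-constant top strain eigenvalue costs.** If `λ₁`
takes two different values, then `heatDissipation Φ_q v > 0` at EVERY real `q ≥ 2`. [ours] -/
theorem heatDissipation_topEigMoment_pos_of_ne (hd : Fintype.card d = 3) (hq : 2 ≤ q)
    (hv : Torus.IsSmooth v) (hdv : Torus.IsDivFree v) {x y : UnitAddTorus d}
    (hne : torusStrainTopEig v x ≠ torusStrainTopEig v y) :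
    0 < heatDissipation (torusTopEigMoment q) v := by
  by_contra h
  exact hne (torusStrainTopEig_eq_of_heatDissipation_nonpos hd hq hv hdv (not_lt.1 h) x y)

/-- **A strain with `λ₁ = 0` somewhere (e.g. a strain zero) and `Φ_q > 0` is never exact**, at any real
`q ≥ 2`. [ours] -/
theorem heatDissipation_topEigMoment_pos_of_topEig_eq_zero (hd : Fintype.card d = 3) (hq : 2 ≤ q)
    (hv : Torus.IsSmooth v) (hdv : Torus.IsDivFree v) {x₀ : UnitAddTorus d}
    (h0 : torusStrainTopEig v x₀ = 0) (hΦ : 0 < torusTopEigMoment q v) :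
    0 < heatDissipation (torusTopEigMoment q) v := by
  by_contra h
  have hq0 : q ≠ 0 := by linarith
  have e := torusTopEigMoment_eq_rpow_of_heatDissipation_nonpos hd hq hv hdv (not_lt.1 h) x₀ q
  rw [h0, Real.zero_rpow hq0] at e
  exact absurd e hΦ.ne'

end IsoTop

/-! ## § 4 On `T³`: exact at one exponent `q₀ ≥ 2` ⇒ exact at every exponent `q > 1` -/

section Universal

open StrainL4

variable {v : UnitAddTorus (Fin 3) → EuclideanSpace ℝ (Fin 3)}

/-- Danskinʼs formula on a frozen top: if `λ₁ ≡ m` then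
`heatDissipation Φ_q v = −(q m^{q−1}) ∫ μ(S; ΔS)` for every real `q ≥ 1`. [ours] -/
theorem heatDissipation_topEigMoment_eq_of_const {q : ℝ} (hq : 1 ≤ q) (hv : Torus.IsSmooth v)
    (hdv : Torus.IsDivFree v) {m : ℝ} (hm : ∀ x, torusStrainTopEig v x = m) :
    heatDissipation (torusTopEigMoment q) v =
      -(q * m ^ (q - 1)) * ∫ x, dirTopEig (strainFlat v x) (strainFlat (Torus.laplacian v) x) := by
  rw [heatDissipation_topEigMoment_eq_integral hq hv hdv]
  simp_rw [hm]
  rw [integral_const_mul]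
  ring

/-- **EXACT ONCE ⇒ EXACT ALWAYS.** On `T³`, a smooth divergence-free `v` with
`heatDissipation Φ_{q₀} v ≤ 0` for ONE real `q₀ ≥ 2` has `heatDissipation Φ_q v = 0` for EVERY real
`q > 1`: by ISO-TOP `λ₁ ≡ m`; if `m = 0` every `Φ_q`-price vanishes termwise (`0^{q−1} = 0`); if `m > 0`
Danskin gives `heatDissipation Φ_q v = −q m^{q−1} ∫μ`, exactness at `q₀` gives `∫μ ≥ 0`, the heat sieve
at `q` gives `∫μ ≤ 0`. Sharpens K50 (R8): no exponent `q₀ ≥ 2` is an isolated exact exponent. [ours] -/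
theorem heatDissipation_topEigMoment_eq_zero_of_exact {q₀ : ℝ} (hq₀ : 2 ≤ q₀)
    (hv : Torus.IsSmooth v) (hdv : Torus.IsDivFree v)
    (hT₀ : heatDissipation (torusTopEigMoment q₀) v ≤ 0) {q : ℝ} (hq : 1 < q) :
    heatDissipation (torusTopEigMoment q) v = 0 := by
  have hd : Fintype.card (Fin 3) = 3 := Fintype.card_fin 3
  set m : ℝ := torusStrainTopEig v 0 with hmdef
  have hm : ∀ x, torusStrainTopEig v x = m := fun x =>
    torusStrainTopEig_eq_of_heatDissipation_nonpos hd hq₀ hv hdv hT₀ x 0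
  have hmnn : 0 ≤ m := by
    rw [hmdef, ← lam_strainFlat]; exact lam_strainFlat_nonneg hv hdv 0
  have hq1 : (1 : ℝ) ≤ q := hq.le
  have eq_q := heatDissipation_topEigMoment_eq_of_const hq1 hv hdv hm
  have eq_q₀ := heatDissipation_topEigMoment_eq_of_const (by linarith : (1 : ℝ) ≤ q₀) hv hdv hm
  -- the treeʼs heat sieve `0 ≤ heatDissipation Φ_q v` (`TopEigHeatStable`, admissible core `λ₁`)
  have hsieve : 0 ≤ heatDissipation (torusTopEigMoment q) v :=
    heatDissipation_nonneg_of_admissible hq1 convexOn_lam lipschitzWith_lam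
      (fun _ hv hdiv x => lam_strainFlat_nonneg hv hdiv x)
      (fun _ hv hdiv => torusTopEigMoment_eq hv hdiv q) hv hdv
  set I : ℝ := ∫ x, dirTopEig (strainFlat v x) (strainFlat (Torus.laplacian v) x) with hI
  rcases eq_or_lt_of_le hmnn with h0 | hpos
  · -- `m = 0`
    rw [eq_q, ← h0, Real.zero_rpow (by linarith : q - 1 ≠ 0)]
    ring
  · have hc₀ : 0 < q₀ * m ^ (q₀ - 1) := mul_pos (by linarith) (Real.rpow_pos_of_pos hpos _)
    have hc : 0 < q * m ^ (q - 1) := mul_pos (by linarith) (Real.rpow_pos_of_pos hpos _)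
    have hIge : 0 ≤ I := by
      rw [eq_q₀] at hT₀
      by_contra hI'
      have : 0 < -(q₀ * m ^ (q₀ - 1)) * I := by nlinarith [not_le.1 hI']
      linarith
    have hIle : I ≤ 0 := by
      rw [eq_q] at hsieve
      by_contra hI'
      have : -(q * m ^ (q - 1)) * I < 0 := by nlinarith [not_le.1 hI']
      linarith
    have hI0 : I = 0 := le_antisymm hIle hIge
    rw [eq_q, hI0, mul_zero]

/-- **Portrait, amplitude side (summary).** An exact (F2) witness on `T³` at a real exponent
`q₀ ≥ 2` has: a constant top strain eigenvalue `λ₁ ≡ m ≥ 0`, `Φ_p(v) = m^p` for every real `p`, and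
zero heat price `heatDissipation Φ_q v = 0` at every real `q > 1`. [ours] -/
theorem exact_witness_isoTop_portrait {q₀ : ℝ} (hq₀ : 2 ≤ q₀) (hv : Torus.IsSmooth v)
    (hdv : Torus.IsDivFree v) (hT₀ : heatDissipation (torusTopEigMoment q₀) v ≤ 0) :
    ∃ m : ℝ, 0 ≤ m ∧ (∀ x, torusStrainTopEig v x = m) ∧ (∀ p : ℝ, torusTopEigMoment p v = m ^ p) ∧
      ∀ q : ℝ, 1 < q → heatDissipation (torusTopEigMoment q) v = 0 := by
  have hd : Fintype.card (Fin 3) = 3 := Fintype.card_fin 3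
  refine ⟨torusStrainTopEig v 0, ?_, fun x => ?_, fun p => ?_, fun q hq => ?_⟩
  · rw [← lam_strainFlat]; exact lam_strainFlat_nonneg hv hdv 0
  · exact torusStrainTopEig_eq_of_heatDissipation_nonpos hd hq₀ hv hdv hT₀ x 0
  · exact torusTopEigMoment_eq_rpow_of_heatDissipation_nonpos hd hq₀ hv hdv hT₀ 0 p
  · exact heatDissipation_topEigMoment_eq_zero_of_exact hq₀ hv hdv hT₀ hq

end Universal

end TopEig

end Summit.NavierStokesRegularity.FunctionalMining
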